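import Summits.KontsevichZagierPeriods.KontsevichZagierPeriods.Theorems.SoloBlindMZVDuality
import HarnessLib

/-!
# Every multiple zeta value is a box period, by ONE move

The head-product chart `Φ(x)ᵢ = x₀x₁⋯xᵢ` of `SoloBlindZetaBoxChart` maps the open unit box
`(0,1)^w` onto the open ordered simplex `1 > t₀ > ⋯ > t_{w-1} > 0` with Jacobian
`∏ᵢ (x₀⋯x_{i-1})`. Pulling Kontsevich's word integrand `∏ᵢ ω_{εᵢ}(tᵢ)` back along `Φ` gives,
letter by letter (`ω₀(tᵢ) · x₀⋯x_{i-1} = 1/xᵢ`, `ω₁(tᵢ) · x₀⋯x_{i-1} = x₀⋯x_{i-1}/(1 - x₀⋯xᵢ)`),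
the explicit RATIONAL box integrand

  `R_ε(x) = ∏_{i : εᵢ = 0} 1/xᵢ · ∏_{i : εᵢ = 1} (x₀⋯x_{i-1}) / (1 - x₀⋯xᵢ)`

— the integrand one meets when expanding `ζ(s)` as a nested sum of geometric series. Hence:

* `boxWordRep L w` / `boxMZVRep s` — the BOX representation `[(0,1)^w, R_ε]` of a word / of an
  admissible index (rational: `isRational_boxWordRep`; its absolute convergence is TRANSPORTED
  from the simplex along the chart, `integrableOn_boxWordIntegrand`, not assumed);
* `kz_word_box_simplex`, `kz_mzv_box : Equivalent (boxMZVRep s) (mzvSimplexRep s)` — for EVERY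
  admissible index, Kontsevich's simplex representation is one change of variables away from a
  box representation; `boxMZVRep_value : value = ζ(s)` through the move;
* worked instance `ζ(2,1)`: `boxMZVRep [2,1] = [(0,1)³, x₀x₁ dx/((1 - x₀x₁)(1 - x₀x₁x₂))]`
  (`boxWordIntegrand_two_one`), and **Euler's `ζ(2,1) = ζ(3)` as a THREE-move equivalence between
  two rational 3-forms on the same cube**: `[(0,1)³, x₀x₁/((1-x₀x₁)(1-x₀x₁x₂))] ≡
  [(0,1)³, 1/(1-x₀x₁x₂)]` (`kz_box_two_one_box_three`: box → simplex, duality, simplex → box).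

References: D. Zagier, *Values of zeta functions and their applications* (1994), §9;
M. Kontsevich, D. Zagier, *Periods* (2001), §1.1–1.2; F. Beukers, *A note on the irrationality
of `ζ(2)` and `ζ(3)`*, Bull. LMS 11 (1979).
-/

noncomputable section

namespace Summit.KontsevichZagierPeriods.KontsevichZagierPeriods.Theorems

open Set MeasureTheory
open Literature.ModelTheory.ExponentialFields (IsSemialgebraic isSemialgebraic_setOf_eval_pos)
open MvPolynomial (aeval X)
open Literature.NumberTheory.Transcendental
open Literature.NumberTheory.Transcendental.KZ

namespace SoloBlind

variable {w : ℕ}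

/-! ## The box integrand of a word -/

/-- The rational box integrand `R_L(x) = ∏_{Lᵢ = 0} 1/xᵢ · ∏_{Lᵢ = 1} x₀⋯x_{i-1}/(1 - x₀⋯xᵢ)`. -/
def boxWordIntegrand (L : List Bool) (w : ℕ) (x : Fin w → ℝ) : ℝ :=
  ∏ i : Fin w,
    if L.getD i false then headProd x i / (1 - headProd x ((i : ℕ) + 1)) else 1 / x i

/-- The head-product polynomial `X₀ X₁ ⋯ X_{k-1}`. -/
def headPoly (w k : ℕ) : MvPolynomial (Fin w) ℚ := ∏ j ∈ headSet w k, X j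

/-- Numerator polynomial of `R_L`. -/
def boxWordNum (L : List Bool) (w : ℕ) : MvPolynomial (Fin w) ℚ :=
  ∏ i : Fin w, if L.getD i false then headPoly w i else 1

/-- Denominator polynomial of `R_L`. -/
def boxWordDen (L : List Bool) (w : ℕ) : MvPolynomial (Fin w) ℚ :=
  ∏ i : Fin w, if L.getD i false then 1 - headPoly w ((i : ℕ) + 1) else X i

/-- Evaluating the head-product polynomial gives the head product. -/
@[simp] theorem aeval_headPoly (x : Fin w → ℝ) (k : ℕ) : aeval x (headPoly w k) = headProd x k := by
  simp [headPoly, headProd, map_prod]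

/-- Evaluation of the numerator. -/
theorem aeval_boxWordNum (L : List Bool) (x : Fin w → ℝ) :
    aeval x (boxWordNum L w) = ∏ i : Fin w, (if L.getD i false then headProd x i else 1) := by
  simp only [boxWordNum, map_prod]
  refine Finset.prod_congr rfl fun i _ => ?_
  split_ifs <;> simp

/-- Evaluation of the denominator. -/
theorem aeval_boxWordDen (L : List Bool) (x : Fin w → ℝ) :
    aeval x (boxWordDen L w) =
      ∏ i : Fin w, (if L.getD i false then 1 - headProd x ((i : ℕ) + 1) else x i) := by
  simp only [boxWordDen, map_prod]
  refine Finset.prod_congr rfl fun i _ => ?_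
  split_ifs <;> simp

/-- On the open box every head product of positive length lies strictly below `1`. -/
theorem headProd_succ_lt_one {x : Fin w → ℝ} (hx : x ∈ kzOpenBox w) (i : Fin w) :
    headProd x ((i : ℕ) + 1) < 1 := by
  have h := headProd_lt_of_lt hx (Nat.succ_pos i) (Nat.succ_le_of_lt i.2)
  rwa [headProd_zero] at h

/-- The denominator does not vanish on the open box. -/
theorem aeval_boxWordDen_ne_zero (L : List Bool) {x : Fin w → ℝ} (hx : x ∈ kzOpenBox w) :
    aeval x (boxWordDen L w) ≠ 0 := by
  rw [aeval_boxWordDen]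
  refine Finset.prod_ne_zero_iff.mpr fun i _ => ?_
  split_ifs
  · exact (sub_pos.2 (headProd_succ_lt_one hx i)).ne'
  · exact (hx i).1.ne'

/-- `R_L = boxWordNum / boxWordDen` (everywhere, with the junk conventions of division). -/
theorem boxWordIntegrand_eq_aeval_div (L : List Bool) (x : Fin w → ℝ) :
    boxWordIntegrand L w x = aeval x (boxWordNum L w) / aeval x (boxWordDen L w) := by
  rw [aeval_boxWordNum, aeval_boxWordDen, ← Finset.prod_div_distrib, boxWordIntegrand]
  refine Finset.prod_congr rfl fun i _ => ?_
  split_ifs <;> rfl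

/-- `R_L` is a `ℚ`-semialgebraic function on the open box. -/
theorem isSemialgebraicFunOn_boxWordIntegrand (L : List Bool) (w : ℕ) :
    IsSemialgebraicFunOn ℚ (kzOpenBox w) (boxWordIntegrand L w) :=
  (isSemialgebraicFunOn_aeval_div_aeval (isSemialgebraic_kzOpenBox w) (boxWordNum L w)
    (boxWordDen L w) fun _ hx => aeval_boxWordDen_ne_zero L hx).congr fun x _ => by
      rw [boxWordIntegrand_eq_aeval_div]

/-! ## The pull-back identity and transported convergence -/

/-- **Letter by letter**: `R_L(x) = (∏ᵢ ω_{Lᵢ})(Φ x) · |det DΦ(x)|` on the open box. -/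
theorem boxWord_pullback (L : List Bool) {x : Fin w → ℝ} (hx : x ∈ kzOpenBox w) :
    boxWordIntegrand L w x = wordIntegrand L w (boxChart w x) * ∏ i : Fin w, headProd x i := by
  have hx0 : ∀ i, 0 < x i := fun i => (hx i).1
  have hne : ∀ k, headProd x k ≠ 0 := fun k => (headProd_pos hx0 k).ne'
  rw [wordIntegrand, ← Finset.prod_mul_distrib, boxWordIntegrand]
  refine Finset.prod_congr rfl fun i _ => ?_
  rw [boxChart_apply]
  cases L.getD i false
  · simp only [mzvForm, if_false, Bool.false_eq_true]
    rw [headProd_succ x i.2, one_div_mul_eq_div]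
    field_simp [hne i, (hx0 i).ne']
  · simp only [mzvForm, if_true]
    rw [one_div_mul_eq_div]

/-- Absolute convergence of `R_L` on the box, TRANSPORTED from the simplex along the chart. -/
theorem integrableOn_boxWordIntegrand (L : List Bool)
    (hint : IntegrableOn (wordIntegrand L w) (openOrderedSimplex w)) :
    IntegrableOn (boxWordIntegrand L w) (kzOpenBox w) := by
  obtain ⟨-, hderiv, hinj, himage, hdet⟩ := exists_boxChart w
  rw [← himage] at hint
  exact (integrableOn_iff_of_chart (measurableSet_kzOpenBox w) hderiv hinj hdet
    (fun x hx => boxWord_pullback L hx)).mp hint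

/-! ## Box representations -/

/-- **The box representation** `[(0,1)^w, R_L]` of a binary word whose simplex integral converges
absolutely. -/
def boxWordRep (L : List Bool) (w : ℕ)
    (hint : IntegrableOn (wordIntegrand L w) (openOrderedSimplex w)) : IntegralRep w where
  domain := kzOpenBox w
  integrand := boxWordIntegrand L w
  isSemialgebraic_domain := isSemialgebraic_kzOpenBox w
  isSemialgebraicFunOn_integrand := isSemialgebraicFunOn_boxWordIntegrand L w
  integrableOn := integrableOn_boxWordIntegrand L hint

/-- Data of a box representation. -/
@[simp] theorem boxWordRep_domain (L : List Bool) (w : ℕ) (hint) :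
    (boxWordRep L w hint).domain = kzOpenBox w := rfl

/-- Data of a box representation. -/
@[simp] theorem boxWordRep_integrand (L : List Bool) (w : ℕ) (hint) :
    (boxWordRep L w hint).integrand = boxWordIntegrand L w := rfl

/-- Box representations are rational. -/
theorem isRational_boxWordRep (L : List Bool) (w : ℕ) (hint) : (boxWordRep L w hint).IsRational :=
  ⟨boxWordNum L w, boxWordDen L w, fun _ hx => aeval_boxWordDen_ne_zero L hx,
    fun x _ => boxWordIntegrand_eq_aeval_div L x⟩

/-- **One move, every word**: `[(0,1)^w, R_L] ≡ [Δ_w, ∏ ω_{Lᵢ}]` by the head-product chart. -/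
theorem kz_word_box_simplex (L : List Bool) (w : ℕ) (hint) :
    Equivalent (boxWordRep L w hint) (wordRep L w hint) := by
  obtain ⟨hsa, hderiv, hinj, himage, hdet⟩ := exists_boxChart w
  exact equivalent_of_chart hsa hderiv hinj himage hdet (f := boxWordIntegrand L w)
    (g := wordIntegrand L w) (fun x hx => boxWord_pullback L hx) rfl (fun _ _ => rfl) rfl
    (fun _ _ => rfl)

/-- **The box representation of `ζ(s)`**, `B_s = [(0,1)^w, R_{ε(s)}]`. -/
def boxMZVRep (s : List ℕ) (hs : MZV.IsAdmissible s) : IntegralRep (MZV.weight s) :=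
  boxWordRep (MZV.binaryWord s) (MZV.weight s) (mzvIntegrand_integrableOn_holds s hs)

/-- `B_s` is rational. -/
theorem isRational_boxMZVRep (s : List ℕ) (hs : MZV.IsAdmissible s) :
    (boxMZVRep s hs).IsRational :=
  isRational_boxWordRep _ _ _

/-- **Every MZV is a box period, one move from Kontsevich's simplex**: `B_s ≡ Λ_s`. -/
theorem kz_mzv_box (s : List ℕ) (hs : MZV.IsAdmissible s) :
    Equivalent (boxMZVRep s hs) (mzvSimplexRep s hs) :=
  kz_word_box_simplex _ _ _

/-- The value through the move: `∫_{(0,1)^w} R_{ε(s)} = ζ(s)`. -/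
theorem boxMZVRep_value (s : List ℕ) (hs : MZV.IsAdmissible s) :
    (boxMZVRep s hs).value = multipleZeta s := by
  have hk := relations_le_ker_eval_holds (kz_mzv_box s hs)
  rw [AddMonoidHom.mem_ker, map_sub, eval_of, eval_of, sub_eq_zero, mzvSimplexRep_value] at hk
  exact hk

/-- **Box duality in three moves**: the box representations of dual indices are KZ-equivalent
(box → simplex → dual simplex → box). -/
theorem kz_mzv_box_duality {s s' : List ℕ} (hs : MZV.IsAdmissible s) (hs' : MZV.IsAdmissible s')
    (h : MZV.binaryWord s' = (MZV.binaryWord s).reverse.map fun b => !b) :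
    Equivalent (boxMZVRep s hs) (boxMZVRep s' hs') :=
  ((kz_mzv_box s hs).trans (kz_mzv_duality hs hs' h)).trans (kz_mzv_box s' hs').symm

/-! ## The worked instance `ζ(2,1)` -/

/-- The binary word of `(2,1)` is `011`. -/
theorem binaryWord_two_one : MZV.binaryWord [2, 1] = [false, true, true] := by decide

/-- `R_{011}(x) = x₀x₁ / ((1 - x₀x₁)(1 - x₀x₁x₂))` (for `x₀ ≠ 0`). -/
theorem boxWordIntegrand_two_one {x : Fin 3 → ℝ} (hx : x 0 ≠ 0) :
    boxWordIntegrand [false, true, true] 3 x =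
      x 0 * x 1 / ((1 - x 0 * x 1) * (1 - x 0 * x 1 * x 2)) := by
  have h1 : headProd x 1 = x 0 := by
    rw [headProd_succ x (show 0 < 3 by norm_num), headProd_zero, mul_one]; rfl
  have h2 : headProd x 2 = x 0 * x 1 := by
    rw [headProd_succ x (show 1 < 3 by norm_num), h1, mul_comm]; rfl
  have h3 : headProd x 3 = x 0 * x 1 * x 2 := by
    rw [headProd_succ x (show 2 < 3 by norm_num), h2, mul_comm]; rfl
  simp only [boxWordIntegrand, Fin.prod_univ_three, Fin.val_zero, Fin.val_one, Fin.val_two,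
    List.getD_cons_zero, List.getD_cons_succ, if_true, Bool.false_eq_true, if_false, h1, h2, h3,
    zero_add]
  field_simp

/-- **The box of `ζ(2,1)`**: `B_(2,1) = [(0,1)³, x₀x₁ dx/((1 - x₀x₁)(1 - x₀x₁x₂))]` on its
domain. -/
theorem boxMZVRep_two_one_integrand {x : Fin 3 → ℝ} (hx : x ∈ kzOpenBox 3) :
    (boxMZVRep [2, 1] isAdmissible_two_one).integrand x =
      x 0 * x 1 / ((1 - x 0 * x 1) * (1 - x 0 * x 1 * x 2)) := by
  show boxWordIntegrand (MZV.binaryWord [2, 1]) 3 x = _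
  rw [binaryWord_two_one]
  exact boxWordIntegrand_two_one (hx 0).1.ne'

/-- Its domain is the open cube. -/
theorem boxMZVRep_two_one_domain : (boxMZVRep [2, 1] isAdmissible_two_one).domain = kzOpenBox 3 :=
  rfl

/-- **Euler's `ζ(2,1) = ζ(3)` as three moves between two rational 3-forms on the cube**:
`[(0,1)³, x₀x₁/((1-x₀x₁)(1-x₀x₁x₂))] ≡ [(0,1)³, 1/(1-x₀x₁x₂)]`. -/
theorem kz_box_two_one_box_three :
    Equivalent (boxMZVRep [2, 1] isAdmissible_two_one) (boxZetaRep 3 (by norm_num)) :=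
  (kz_mzv_box _ _).trans kz_box_zeta_three_two_one.symm

/-- And the numbers, through the moves: `∫_{(0,1)³} x₀x₁ dx/((1-x₀x₁)(1-x₀x₁x₂)) = ζ(3)`. -/
theorem boxMZVRep_two_one_value :
    (boxMZVRep [2, 1] isAdmissible_two_one).value = zetaValue 3 := by
  have hk := relations_le_ker_eval_holds kz_box_two_one_box_three
  rw [AddMonoidHom.mem_ker, map_sub, eval_of, eval_of, sub_eq_zero, boxZetaRep_value] at hk
  exact hk

end SoloBlind

end Summit.KontsevichZagierPeriods.KontsevichZagierPeriods.Theorems
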